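import Mathlib.Analysis.Calculus.LocalExtr.Basic
import Mathlib.Analysis.SpecialFunctions.ExpDeriv
import Mathlib.Topology.MetricSpace.ProperSpace
import Literature.Computability.AlgebraicComplexity.TensorPowerAction
import Literature.Computability.AlgebraicComplexity.MatrixKAK
import HarnessLib

/-!
# Minimal representatives modulo the stabiliser and the first-order condition (Kempf–Ness)

Support file for the proof of Bürgisser–Ikenmeyer 2017, Cor. 2.9 (`det_n` and `per_n` are
polystable, `Polystability.lean`), Kempf–Ness part, for the tensor power action `tensorAct` of
`TensorPowerAction.lean`. Proved here:

* norm bookkeeping along `KAK`: `tnormSq_tensorAct_kak`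
  (`‖(V diag(e^θ) W) • T‖² = ∑ j, e^{2 ∑ k θ (j k)} ‖(W • T) j‖²`), `tensorAct_diagonal_exp_eq_self`,
  `det_diagonal_exp_eq_one`;
* `exists_frobSq_minimizer` — among the matrices `M` with `det M = 1` and `M • T₀ = g • T₀` (a closed
  set: the coset of `g` modulo the stabiliser of `T₀` in `SL`) the squared Frobenius norm
  `∑ i j, ‖M i j‖²` attains its minimum (properness of the norm on closed sets of matrices);
* `firstOrder_of_frobSq_minimizer` — **first-order condition** at such a minimiser `g'`: for
  unitary `U` and real traceless `θ` whose weights vanish on the support of `Uᴴ • T₀` (so that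
  `s ↦ U diag(e^{sθ}) Uᴴ` is a one-parameter subgroup of the stabiliser),
  `∑ a, θ a * ∑ i, ‖(g' U) i a‖² = 0` (derivative at `s = 0` of the norm along the subgroup,
  `IsLocalMin.hasDerivAt_eq_zero`).

This is the stabiliser-coset device replacing, in Kempf–Ness 1979 (proof of Thm. 0.1), the appeal
to the Hilbert–Mumford criterion. Everything is proved; [folklore].

## References

* G. Kempf, L. Ness, *The length of vectors in representation spaces*, LNM 732 (1979), §0–1.
-/

noncomputable section

open Finset Filter
open scoped Matrix ComplexOrder Topology

namespace Literature.Computability.AlgebraicComplexity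

/-! ### Norm identities for the tensor action -/
section TensorNorms

variable {σ : Type*} [Fintype σ] [DecidableEq σ] {n : ℕ}

/-- `‖(V * diag(exp θ) * W) • T‖² = ∑ j, exp (2 ∑ k, θ (j k)) * ‖(W • T) j‖²` for unitary `V`.
[folklore] -/
theorem tnormSq_tensorAct_kak {V : Matrix σ σ ℂ} (hV : Vᴴ * V = 1) (θ : σ → ℝ)
    (W : Matrix σ σ ℂ) (T : (Fin n → σ) → ℂ) :
    tnormSq (tensorAct (V * Matrix.diagonal (fun c => (Real.exp (θ c) : ℂ)) * W) T) =
      ∑ j : Fin n → σ, Real.exp (2 * ∑ k, θ (j k)) * ‖tensorAct W T j‖ ^ 2 := by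
  rw [tensorAct_mul, tensorAct_mul, tnormSq_tensorAct_of_conjTranspose_mul_self hV,
    tnormSq_tensorAct_diagonal]
  refine Finset.sum_congr rfl fun j _ => ?_
  congr 1
  have : ∀ k, ‖(Real.exp (θ (j k)) : ℂ)‖ = Real.exp (θ (j k)) := fun k => by
    rw [Complex.norm_real, Real.norm_eq_abs, abs_of_pos (Real.exp_pos _)]
  simp_rw [this]
  rw [← Real.exp_sum, ← Real.exp_nat_mul]
  norm_num

/-- A diagonal matrix `diag(exp (s θ))` fixes a tensor all of whose active words have weight
`∑ k, θ (j k) = 0`. [folklore] -/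
theorem tensorAct_diagonal_exp_eq_self {θ : σ → ℝ} {X : (Fin n → σ) → ℂ}
    (hsupp : ∀ j, X j ≠ 0 → ∑ k, θ (j k) = 0) (s : ℝ) :
    tensorAct (Matrix.diagonal (fun c => (Real.exp (s * θ c) : ℂ))) X = X := by
  rw [tensorAct_diagonal]
  funext j
  by_cases hj : X j = 0
  · rw [hj, mul_zero]
  · have h := hsupp j hj
    have : (∏ k, (Real.exp (s * θ (j k)) : ℂ)) = 1 := by
      rw [← Complex.ofReal_prod, ← Real.exp_sum, ← Finset.mul_sum, h, mul_zero, Real.exp_zero,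
        Complex.ofReal_one]
    rw [this, one_mul]

/-- The determinant of `diag(exp (s θ))` is `1` when `∑ θ = 0`. [folklore] -/
theorem det_diagonal_exp_eq_one {θ : σ → ℝ} (hθ : ∑ a, θ a = 0) (s : ℝ) :
    (Matrix.diagonal (fun c => (Real.exp (s * θ c) : ℂ))).det = 1 := by
  rw [Matrix.det_diagonal, ← Complex.ofReal_prod, ← Real.exp_sum, ← Finset.mul_sum, hθ, mul_zero,
    Real.exp_zero, Complex.ofReal_one]

end TensorNorms

/-! ### Minimal representatives and the first-order condition -/
section Minimizer

variable {σ : Type*} [Fintype σ] [DecidableEq σ] {n : ℕ}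

omit [DecidableEq σ] in
/-- The squared Frobenius norm is continuous. [folklore] -/
theorem continuous_frobSq : Continuous fun M : Matrix σ σ ℂ => ∑ i, ∑ j, ‖M i j‖ ^ 2 := by
  refine continuous_finsetSum _ fun i _ => continuous_finsetSum _ fun j _ => ?_
  exact (((continuous_apply j).comp (continuous_apply i)).norm).pow 2

omit [DecidableEq σ] in
/-- An entry is bounded by the Frobenius norm: `‖M i j‖² ≤ ∑ i j, ‖M i j‖²`. [folklore] -/
theorem norm_sq_le_frobSq (M : Matrix σ σ ℂ) (i j : σ) : ‖M i j‖ ^ 2 ≤ ∑ i, ∑ j, ‖M i j‖ ^ 2 := by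
  refine le_trans ?_ (Finset.single_le_sum (f := fun i => ∑ j, ‖M i j‖ ^ 2)
    (fun i _ => Finset.sum_nonneg fun j _ => by positivity) (Finset.mem_univ i))
  exact Finset.single_le_sum (f := fun j => ‖M i j‖ ^ 2) (fun j _ => by positivity) (Finset.mem_univ j)

omit [DecidableEq σ] in
/-- Sublevel sets of the Frobenius norm are compact. [folklore] -/
theorem isCompact_frobSq_le (R : ℝ) : IsCompact {M : Matrix σ σ ℂ | ∑ i, ∑ j, ‖M i j‖ ^ 2 ≤ R} := by
  set box : Set (Matrix σ σ ℂ) :=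
    Set.univ.pi fun _ : σ => Set.univ.pi fun _ : σ => Metric.closedBall (0 : ℂ) (Real.sqrt R) with hbox
  have hbox_c : IsCompact box :=
    isCompact_univ_pi fun _ => isCompact_univ_pi fun _ => isCompact_closedBall (0 : ℂ) _
  refine hbox_c.of_isClosed_subset (isClosed_le continuous_frobSq continuous_const) fun M hM =>
    Set.mem_univ_pi.mpr fun i => Set.mem_univ_pi.mpr fun j => ?_
  rw [Metric.mem_closedBall, dist_zero_right]
  refine Real.le_sqrt_of_sq_le ?_
  exact le_trans (norm_sq_le_frobSq M i j) hM

omit [DecidableEq σ] in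
/-- The tensor action is continuous in the matrix. [folklore] -/
theorem continuous_tensorAct_left (T : (Fin n → σ) → ℂ) :
    Continuous fun M : Matrix σ σ ℂ => tensorAct M T :=
  continuous_tensorAct.comp (continuous_id.prodMk continuous_const)

/-- **Minimal representatives exist**: in the closed set of matrices of determinant `1` mapping `T₀`
to a given tensor, the Frobenius norm attains its infimum (Kempf–Ness 1979, proof of Thm. 0.1:
minimal vectors in a closed orbit of the stabiliser). [folklore] -/
theorem exists_frobSq_minimizer (T₀ : (Fin n → σ) → ℂ) {g : Matrix σ σ ℂ} (hg : g.det = 1) :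
    ∃ g' : Matrix σ σ ℂ, g'.det = 1 ∧ tensorAct g' T₀ = tensorAct g T₀ ∧
      ∀ M : Matrix σ σ ℂ, M.det = 1 → tensorAct M T₀ = tensorAct g T₀ →
        ∑ i, ∑ j, ‖g' i j‖ ^ 2 ≤ ∑ i, ∑ j, ‖M i j‖ ^ 2 := by
  set Rep : Set (Matrix σ σ ℂ) := {M | M.det = 1 ∧ tensorAct M T₀ = tensorAct g T₀} with hRep
  have hRep_closed : IsClosed Rep := by
    refine IsClosed.inter ?_ ?_
    · exact isClosed_eq (continuous_id.matrix_det) continuous_const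
    · exact isClosed_eq (continuous_tensorAct_left T₀) continuous_const
  set K : Set (Matrix σ σ ℂ) := Rep ∩ {M | ∑ i, ∑ j, ‖M i j‖ ^ 2 ≤ ∑ i, ∑ j, ‖g i j‖ ^ 2} with hK
  have hK_cpt : IsCompact K := (isCompact_frobSq_le _).inter_left hRep_closed
  have hgK : g ∈ K := ⟨⟨hg, rfl⟩, show (∑ i, ∑ j, ‖g i j‖ ^ 2) ≤ ∑ i, ∑ j, ‖g i j‖ ^ 2 from le_rfl⟩
  obtain ⟨g', hg'K, hmin⟩ := hK_cpt.exists_isMinOn ⟨g, hgK⟩ continuous_frobSq.continuousOn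
  refine ⟨g', hg'K.1.1, hg'K.1.2, fun M hM hMT => ?_⟩
  by_cases hle : ∑ i, ∑ j, ‖M i j‖ ^ 2 ≤ ∑ i, ∑ j, ‖g i j‖ ^ 2
  · exact hmin ⟨⟨hM, hMT⟩, hle⟩
  · push Not at hle
    exact le_trans hg'K.2 hle.le

/-- **First-order condition at a minimal representative** (Kempf–Ness 1979, proof of Thm. 0.2):
if `g'` has least Frobenius norm among the matrices of determinant `1` with `M • T₀ = g' • T₀`,
then for every unitary `U` and every real traceless weight `θ` killing the words in the support
of `Uᴴ • T₀` (so that `U diag(e^{sθ}) Uᴴ` is a one-parameter subgroup of the stabiliser of `T₀`),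
`∑ a, θ a * ∑ i, ‖(g' U) i a‖² = 0`. [folklore] -/
theorem firstOrder_of_frobSq_minimizer (T₀ : (Fin n → σ) → ℂ) {g' : Matrix σ σ ℂ}
    (hg' : g'.det = 1)
    (hmin : ∀ M : Matrix σ σ ℂ, M.det = 1 → tensorAct M T₀ = tensorAct g' T₀ →
      ∑ i, ∑ j, ‖g' i j‖ ^ 2 ≤ ∑ i, ∑ j, ‖M i j‖ ^ 2)
    {U : Matrix σ σ ℂ} (hU : U ∈ Matrix.unitaryGroup σ ℂ) (θ : σ → ℝ) (hθ : ∑ a, θ a = 0)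
    (hsupp : ∀ j, tensorAct (star U) T₀ j ≠ 0 → ∑ k, θ (j k) = 0) :
    ∑ a, θ a * ∑ i, ‖(g' * U) i a‖ ^ 2 = 0 := by
  have hUU : U * star U = 1 := Matrix.mem_unitaryGroup_iff.mp hU
  have hUU' : star U * U = 1 := Matrix.mem_unitaryGroup_iff'.mp hU
  -- the one-parameter subgroup `c s = U diag(e^{sθ}) Uᴴ` of the stabiliser
  set D : ℝ → Matrix σ σ ℂ := fun s => Matrix.diagonal (fun c => (Real.exp (s * θ c) : ℂ)) with hD
  set c : ℝ → Matrix σ σ ℂ := fun s => U * D s * star U with hc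
  have hcdet : ∀ s, (c s).det = 1 := by
    intro s
    rw [hc]
    simp only
    rw [Matrix.det_mul, Matrix.det_mul, hD]
    simp only
    rw [det_diagonal_exp_eq_one hθ s, mul_one, ← Matrix.det_mul, hUU, Matrix.det_one]
  have hcT : ∀ s, tensorAct (c s) T₀ = T₀ := by
    intro s
    rw [hc]
    simp only
    rw [tensorAct_mul, tensorAct_mul, hD]
    simp only
    rw [tensorAct_diagonal_exp_eq_self hsupp s, ← tensorAct_mul, hUU, tensorAct_one]
  -- the norm along the curve
  set ψ : ℝ → ℝ := fun s => ∑ i, ∑ a, ‖(g' * U) i a‖ ^ 2 * Real.exp (2 * θ a * s) with hψ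
  have hψ_eq : ∀ s, ∑ i, ∑ a, ‖(g' * c s) i a‖ ^ 2 = ψ s := by
    intro s
    have hsU : (star U) * (star U)ᴴ = 1 := by
      rw [← Matrix.star_eq_conjTranspose, star_star]
      exact hUU'
    have : g' * c s = (g' * U * D s) * star U := by
      rw [hc]; simp only [Matrix.mul_assoc]
    rw [this, frobSq_mul_of_mul_conjTranspose_self hsU, hψ]
    refine Finset.sum_congr rfl fun i _ => Finset.sum_congr rfl fun a _ => ?_
    rw [hD]
    simp only
    rw [Matrix.mul_diagonal, norm_mul, Complex.norm_real, Real.norm_eq_abs,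
      abs_of_pos (Real.exp_pos _), mul_pow, ← Real.exp_nat_mul]
    congr 1
    congr 1
    push_cast
    ring
  -- `ψ` is minimal at `0`
  have hψ0 : ψ 0 = ∑ i, ∑ j, ‖g' i j‖ ^ 2 := by
    rw [← hψ_eq 0]
    have : c 0 = 1 := by
      rw [hc]; simp only
      rw [hD]; simp only
      simp only [zero_mul, Real.exp_zero, Complex.ofReal_one, Matrix.diagonal_one, Matrix.mul_one]
      exact hUU
    rw [this, Matrix.mul_one]
  have hψmin : IsMinOn ψ Set.univ 0 := by
    intro s _
    show ψ 0 ≤ ψ s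
    rw [hψ0, ← hψ_eq s]
    refine hmin (g' * c s) ?_ ?_
    · rw [Matrix.det_mul, hg', hcdet, one_mul]
    · rw [tensorAct_mul, hcT]
  have hloc : IsLocalMin ψ 0 := hψmin.isLocalMin Filter.univ_mem
  -- derivative of `ψ` at `0`
  have hderiv : HasDerivAt ψ (∑ i, ∑ a, ‖(g' * U) i a‖ ^ 2 * (2 * θ a)) 0 := by
    have hψ' : ψ = fun s => ∑ i, ∑ a, ‖(g' * U) i a‖ ^ 2 * Real.exp (2 * θ a * s) := rfl
    rw [hψ']
    have hterm : ∀ i a, HasDerivAt (fun s : ℝ => ‖(g' * U) i a‖ ^ 2 * Real.exp (2 * θ a * s))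
        (‖(g' * U) i a‖ ^ 2 * (2 * θ a)) 0 := by
      intro i a
      have h1 : HasDerivAt (fun s : ℝ => 2 * θ a * s) (2 * θ a) 0 := by
        simpa using (hasDerivAt_id (0 : ℝ)).const_mul (2 * θ a)
      have h2 := h1.exp
      simp only [mul_zero, Real.exp_zero, one_mul] at h2
      exact h2.const_mul _
    have := HasDerivAt.fun_sum (u := Finset.univ) fun i (_ : i ∈ Finset.univ) =>
      HasDerivAt.fun_sum (u := Finset.univ) fun a (_ : a ∈ Finset.univ) => hterm i a
    exact this
  have hzero := hloc.hasDerivAt_eq_zero hderiv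
  -- rearrange
  have : ∑ i, ∑ a, ‖(g' * U) i a‖ ^ 2 * (2 * θ a) = 2 * ∑ a, θ a * ∑ i, ‖(g' * U) i a‖ ^ 2 := by
    rw [Finset.sum_comm, Finset.mul_sum]
    refine Finset.sum_congr rfl fun a _ => ?_
    rw [Finset.mul_sum, Finset.mul_sum]
    refine Finset.sum_congr rfl fun i _ => by ring
  rw [this] at hzero
  linarith

end Minimizer

end Literature.Computability.AlgebraicComplexity
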